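import Summits.CriticalPhenomena.PercolationContinuityZ3.Theorems.Transplant.FKConnectivityAllQAntipodalTwoSpineDefs
import HarnessLib

/-!
# Connectivity correlation inequalities for `φ_{w,q}` — TWO-SPINE word model: the SUMMATION LEMMA of the certificate rule

Helper file (`--supports stmt-CriticalPhenomena-4575`), FK sub-lane `prim-bschramm-fk-2` (gen 16); builds on p205010 (kernel theorem,
internal audit signed; external expert review pending).  No named facts, no sorries, standard axioms.  Pure `Finset` bookkeeping.

Memo `bschramm/FROM-fk-2-g15-TWO-SPINE.md` §10.9/§10.14 and blueprint `prim-bschramm-fk-2-g15/BLUEPRINT-U11-LEAN.md` L2.4.  A signed sum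
`∑_{c ∈ C} W(c) · sign(c) · T(c)` over CELLS `c` with `sign ∈ {-1, 0, 1}`, nonnegative test values `T` and nonnegative weights
`W(c) = ∑_{k ∈ At(c)} ω(c, k)` split into ATOMS is nonnegative as soon as a MIXED MATCHING exists: every negative cell is either sent
WHOLE to a positive cell of no smaller total mass (`φ`, injective), or ATOM BY ATOM to atom slots of positive cells not used by the whole
moves (`ψ`, injective on pieces, each piece dominated by its target piece).  This is the abstract form of the soundness of gen 15's
two-spine RULE (`(R1)` = Theorem U's injection on non-critical cells, `(R2)` = the atom moves on critical cells); the rule itself is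
supplied by `…TwoSpineRuleR1/R2` and assembled in `…TwoSpineRule`.
[cite: Grimmett2006, §3.9 (p. 63)]
-/

namespace Summit.CriticalPhenomena.PercolationContinuityZ3.Theorems

namespace FK

namespace TwoSpine

open Finset

variable {ι κ : Type*} [DecidableEq ι] [DecidableEq κ]

/-! ### Pieces: (cell, atom) pairs -/

/-- The PIECES of a set of cells: the pairs `(c, k)` with `c ∈ D` and `k` an atom of `c`. [folklore] -/
def pieces (D : Finset ι) (At : ι → Finset κ) : Finset (ι × κ) := D.biUnion fun c => (At c).image fun k => (c, k)

/-- Membership in `pieces`. [folklore] -/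
theorem mem_pieces {D : Finset ι} {At : ι → Finset κ} {p : ι × κ} : p ∈ pieces D At ↔ p.1 ∈ D ∧ p.2 ∈ At p.1 := by
  constructor
  · intro hp
    obtain ⟨c, hc, hp⟩ := Finset.mem_biUnion.1 hp
    obtain ⟨k, hk, rfl⟩ := Finset.mem_image.1 hp
    exact ⟨hc, hk⟩
  · rintro ⟨h1, h2⟩
    exact Finset.mem_biUnion.2 ⟨p.1, h1, Finset.mem_image.2 ⟨p.2, h2, rfl⟩⟩

/-- Summing over pieces is the double sum over cells and their atoms. [folklore] -/
theorem sum_pieces (D : Finset ι) (At : ι → Finset κ) (G : ι × κ → ℝ) :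
    ∑ p ∈ pieces D At, G p = ∑ c ∈ D, ∑ k ∈ At c, G (c, k) := by
  unfold pieces
  rw [Finset.sum_biUnion]
  · refine Finset.sum_congr rfl fun c _ => ?_
    rw [Finset.sum_image fun k _ k' _ h => (Prod.mk.inj h).2]
  · intro c _ c' _ hcc'
    refine Finset.disjoint_left.2 fun p hp hp' => hcc' ?_
    obtain ⟨k, _, rfl⟩ := Finset.mem_image.1 hp
    obtain ⟨k', _, h⟩ := Finset.mem_image.1 hp'
    exact ((Prod.mk.inj h).1).symm

/-! ### The summation lemma -/

/-- **Summation lemma of the mixed matching** (memo g15 §10.9/§10.14, blueprint L2.4).  Cells `C` with signs in `{-1,0,1}`, nonnegative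
test values `T` and atom weights `ω ≥ 0`; `D` a set of negative cells moved WHOLE by `φ` (injective on `D`, into positive cells, total
mass not decreased), the remaining negative cells moved PIECE BY PIECE by `ψ` (injective on their pieces, into atom slots of positive cells
outside `φ(D)`, each piece dominated).  Then `0 ≤ ∑_{c ∈ C} (∑_{k ∈ At c} ω c k) · sign c · T c`. [folklore] -/
theorem sum_sign_nonneg_of_matching (C : Finset ι) (At : ι → Finset κ) (sign : ι → ℝ) (ω : ι → κ → ℝ) (T : ι → ℝ)
    (hsign : ∀ c ∈ C, sign c = -1 ∨ sign c = 0 ∨ sign c = 1)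
    (hω : ∀ c, ∀ k ∈ At c, 0 ≤ ω c k) (hT : ∀ c, 0 ≤ T c)
    (D : Finset ι) (hD : D ⊆ C.filter fun c => sign c = -1)
    (φ : ι → ι) (hφmem : ∀ c ∈ D, φ c ∈ C ∧ sign (φ c) = 1) (hφinj : ∀ c₁ ∈ D, ∀ c₂ ∈ D, φ c₁ = φ c₂ → c₁ = c₂)
    (hφle : ∀ c ∈ D, (∑ k ∈ At c, ω c k) * T c ≤ (∑ k ∈ At (φ c), ω (φ c) k) * T (φ c))
    (ψ : ι × κ → ι × κ)
    (hψmem : ∀ p ∈ pieces ((C.filter fun c => sign c = -1) \ D) At,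
      (ψ p).1 ∈ C ∧ sign (ψ p).1 = 1 ∧ (ψ p).2 ∈ At (ψ p).1 ∧ (ψ p).1 ∉ D.image φ)
    (hψinj : ∀ p₁ ∈ pieces ((C.filter fun c => sign c = -1) \ D) At, ∀ p₂ ∈ pieces ((C.filter fun c => sign c = -1) \ D) At,
      ψ p₁ = ψ p₂ → p₁ = p₂)
    (hψle : ∀ p ∈ pieces ((C.filter fun c => sign c = -1) \ D) At, ω p.1 p.2 * T p.1 ≤ ω (ψ p).1 (ψ p).2 * T (ψ p).1) :
    0 ≤ ∑ c ∈ C, (∑ k ∈ At c, ω c k) * sign c * T c := by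
  set Lm := C.filter fun c => sign c = -1 with hLm
  set Lp := C.filter fun c => sign c = 1 with hLp
  set W : ι → ℝ := fun c => ∑ k ∈ At c, ω c k with hWdef
  have hW : ∀ c, 0 ≤ W c := fun c => Finset.sum_nonneg (hω c)
  -- the signed sum is `Σ_{Lp} W T - Σ_{Lm} W T`
  have hsplit : ∑ c ∈ C, W c * sign c * T c = ∑ c ∈ Lp, W c * T c - ∑ c ∈ Lm, W c * T c := by
    rw [hLp, hLm, Finset.sum_filter, Finset.sum_filter, ← Finset.sum_sub_distrib]
    refine Finset.sum_congr rfl fun c hc => ?_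
    rcases hsign c hc with h | h | h <;> norm_num [h]
  change 0 ≤ ∑ c ∈ C, W c * sign c * T c
  rw [hsplit, sub_nonneg]
  -- split the negative cells into whole-moved and piece-moved ones
  have hLm_split : ∑ c ∈ Lm, W c * T c = ∑ c ∈ D, W c * T c + ∑ c ∈ Lm \ D, W c * T c := by
    rw [← Finset.sum_union Finset.disjoint_sdiff, Finset.union_sdiff_of_subset hD]
  -- whole moves
  have hDφ : D.image φ ⊆ Lp := by
    intro c hc
    obtain ⟨c₀, hc₀, rfl⟩ := Finset.mem_image.1 hc
    exact Finset.mem_filter.2 (hφmem c₀ hc₀)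
  have h1 : ∑ c ∈ D, W c * T c ≤ ∑ c ∈ D.image φ, W c * T c := by
    rw [Finset.sum_image hφinj]
    exact Finset.sum_le_sum fun c hc => hφle c hc
  -- atom moves
  set P := pieces (Lm \ D) At with hP
  have h2 : ∑ c ∈ Lm \ D, W c * T c = ∑ p ∈ P, ω p.1 p.2 * T p.1 := by
    rw [hP, sum_pieces]
    exact Finset.sum_congr rfl fun c _ => by simp only [hWdef]; rw [Finset.sum_mul]
  have h3 : ∑ p ∈ P, ω p.1 p.2 * T p.1 ≤ ∑ p ∈ P.image ψ, ω p.1 p.2 * T p.1 := by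
    rw [Finset.sum_image hψinj]
    exact Finset.sum_le_sum fun p hp => hψle p hp
  have h4 : ∑ p ∈ P.image ψ, ω p.1 p.2 * T p.1 ≤ ∑ p ∈ pieces (Lp \ D.image φ) At, ω p.1 p.2 * T p.1 := by
    refine Finset.sum_le_sum_of_subset_of_nonneg ?_ fun p hp _ => mul_nonneg (hω p.1 p.2 (mem_pieces.1 hp).2) (hT p.1)
    intro p hp
    obtain ⟨p₀, hp₀, rfl⟩ := Finset.mem_image.1 hp
    obtain ⟨hC, hs, hAt, hnot⟩ := hψmem p₀ hp₀
    exact mem_pieces.2 ⟨Finset.mem_sdiff.2 ⟨Finset.mem_filter.2 ⟨hC, hs⟩, hnot⟩, hAt⟩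
  have h5 : ∑ p ∈ pieces (Lp \ D.image φ) At, ω p.1 p.2 * T p.1 = ∑ c ∈ Lp \ D.image φ, W c * T c := by
    rw [sum_pieces]
    exact Finset.sum_congr rfl fun c _ => by simp only [hWdef]; rw [Finset.sum_mul]
  have h6 : ∑ c ∈ D.image φ, W c * T c + ∑ c ∈ Lp \ D.image φ, W c * T c = ∑ c ∈ Lp, W c * T c := by
    rw [← Finset.sum_union Finset.disjoint_sdiff, Finset.union_sdiff_of_subset hDφ]
  linarith

end TwoSpine

end FK

end Summit.CriticalPhenomena.PercolationContinuityZ3.Theorems
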